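import Literature.NumberTheory.LFunctions.ExplicitZeroFreeRegionKernel
import Mathlib.Analysis.Calculus.Deriv.Star
import HarnessLib

/-!
# Kadiri's hypothesis (H₂) for the Mossinghoff–Trudgian–Yang kernel: the Laplace transform of `h^{(1)}_{1,θ}` has non-negative real part

Topic `Literature/NumberTheory/LFunctions`; fourth file of the decomposition of the named fact
`Literature.NumberTheory.LFunctions.zero_free_region_mossinghoff_trudgian_yang` (rh.S09 explicit;
Mossinghoff–Trudgian–Yang 2024 = arXiv:2212.06867, Theorem 1.3), continuing
`ExplicitZeroFreeRegionKernel.lean` (where the §9 kernel `h^{(1)}_{1,θ}` of MTY (9.2),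
`mtyH1 1 θ`, was identified with the self-convolution `w = g ∗ g` of Ford's `g` of MTY (4.3) and
Kadiri's conditions (H₁) were proved). Kadiri's method (Acta Arith. 117 (2005), §2) requires of
the test function `f(t) = η h_θ(ηt)`, besides (H₁), the positivity hypothesis

> (H₂) `F̃(X, Y) := Re ∫₀^d e^{−(X+iY)t} f(t) dt ≥ 0` whenever `X ≥ 0`,

which is what makes the sum over ALL non-trivial zeros in the smoothed explicit formula
one-signed (Kadiri, Prop. 2.6, after Stechkin); Kadiri takes it from Heath-Brown 1992, Lemma 7.5.
**This file PROVES (H₂) for the MTY kernel** (`mtyH1_laplace_re_nonneg`: for `0 < θ < π/2`,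
`X ≥ 0`, `Y ∈ ℝ`, `∫₀^{d₁(θ)} h^{(1)}_{1,θ}(u) e^{−Xu} cos(Yu) du ≥ 0`; complex form
`mtyH1_laplace_re_nonneg'`; scaled form for `f(t) = η h(ηt)`, `kadiri_f_laplace_re_nonneg`).
Everything here is proved; no named fact is introduced.

## Proof

* `ExpKernel.energy_identity`: for continuous `φ : ℝ → ℂ` on `[a, b]` and real `X`, with
  `U(t) = ∫_a^b φ(s) e^{−X|t−s|} ds` written as `e^{−Xt}P(t) + e^{Xt}Q(t)`
  (`P(t) = ∫_a^t φ e^{Xs}`, `Q(t) = ∫_t^b φ e^{−Xs}`; `U' = V`, `V' = X²U − 2Xφ` by FTC-1),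
  one integration by parts gives
  `2X ∫_a^b conj(φ) U = X² ∫‖U‖² + ∫‖U'‖² + X(‖U(b)‖² + ‖U(a)‖²)`, hence
  `Re ∫∫ conj(φ(t)) φ(s) e^{−X|t−s|} ds dt ≥ 0` for `X > 0`
  (`ExpKernel.re_double_integral_exp_neg_abs_nonneg`; the case `X = 0` is `|∫φ|² ≥ 0`,
  `ExpKernel.re_double_integral_nonneg_zero`). This is the classical energy proof that
  `e^{−X|t|}` is a positive-definite function.
* With `φ(s) = g(s) e^{−iYs}` (`fordPhi`; `g` is continuous, `continuous_fordG`, and vanishes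
  off `[−θ cot θ, θ cot θ]`, `fordG_of_le_abs`): `conj(φ(t)) φ(s) e^{−X|t−s|} = M(t, t − s)`,
  `M(t, v) = g(t) g(t−v) e^{−X|v|} e^{iYv}` (`fordM`); substituting `v = t − s`, enlarging the
  window (`fordPhi_inner_integral_eq`), swapping the two integrals (Fubini on a rectangle) and
  recognising `∫ g(t) g(t−v) dt = w(v) = h^{(1)}_{1,θ}(|v|)` (`fordW_eq_mtyH1_abs`,
  `fordM_double_integral_eq`), then taking real parts and folding by evenness
  (`re_weighted_integral_eq`):
  `Re ∫∫ conj(φ(t)) φ(s) e^{−X|t−s|} = 2 ∫₀^{2θcotθ} h^{(1)}_{1,θ}(v) e^{−Xv} cos(Yv) dv`.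

## References

* H. Kadiri, *Une région explicite sans zéros pour la fonction ζ de Riemann*, Acta Arith. 117
  (2005) 303–339 = arXiv:math/0401238, §2 ((H₂); §2.2 `f = η h_θ(η·)`; Prop. 2.6).
  [cite: Kadiri2005]
* M. J. Mossinghoff, T. S. Trudgian, A. Yang, *Explicit zero-free regions for the Riemann
  zeta-function*, Res. Number Theory 10 (2024) = arXiv:2212.06867, (4.3), §9, (9.2).
  [cite: MossinghoffTrudgianYangRNT2024]
* D. R. Heath-Brown, Proc. London Math. Soc. (3) 64 (1992), Lemma 7.1 and Lemma 7.5 (the source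
  of (H₂) in Kadiri; not consulted — the proof here is the direct positive-definiteness argument).
-/

noncomputable section

open Real MeasureTheory Set intervalIntegral
open scoped ComplexConjugate

namespace Literature.NumberTheory.LFunctions

/-! ## Positive-definiteness of `e^{-X|t|}` on a compact interval: the energy identity -/

namespace ExpKernel

/-- `P(t) = ∫_a^t φ(s) e^{Xs} ds`. [folklore] -/
def P (φ : ℝ → ℂ) (X a t : ℝ) : ℂ := ∫ s in a..t, φ s * (Real.exp (X * s) : ℂ)

/-- `Q(t) = ∫_t^b φ(s) e^{-Xs} ds`. [folklore] -/
def Q (φ : ℝ → ℂ) (X b t : ℝ) : ℂ := ∫ s in t..b, φ s * (Real.exp (-(X * s)) : ℂ)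

/-- `U(t) = e^{-Xt} P(t) + e^{Xt} Q(t)` — on `[a, b]` this is `∫_a^b φ(s) e^{-X|t-s|} ds`
(`integral_mul_exp_neg_abs`). [folklore] -/
def U (φ : ℝ → ℂ) (X a b t : ℝ) : ℂ :=
  (Real.exp (-(X * t)) : ℂ) * P φ X a t + (Real.exp (X * t) : ℂ) * Q φ X b t

/-- `V = U'`: `V(t) = -X e^{-Xt} P(t) + X e^{Xt} Q(t)`. [folklore] -/
def V (φ : ℝ → ℂ) (X a b t : ℝ) : ℂ :=
  -(X : ℂ) * (Real.exp (-(X * t)) : ℂ) * P φ X a t + (X : ℂ) * (Real.exp (X * t) : ℂ) * Q φ X b t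

/-- `d/dt e^{-Xt} = -X e^{-Xt}` (complex-valued). [folklore] -/
theorem hasDerivAt_ofReal_exp_neg (X t : ℝ) :
    HasDerivAt (fun t : ℝ ↦ (Real.exp (-(X * t)) : ℂ)) ((-X * Real.exp (-(X * t)) : ℝ) : ℂ) t := by
  have h1 : HasDerivAt (fun t : ℝ ↦ -(X * t)) (-(X * 1)) t := by
    have := ((hasDerivAt_id' t).const_mul X).neg
    exact this
  exact ((h1.exp).congr_deriv (by ring)).ofReal_comp

/-- `d/dt e^{Xt} = X e^{Xt}` (complex-valued). [folklore] -/
theorem hasDerivAt_ofReal_exp (X t : ℝ) :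
    HasDerivAt (fun t : ℝ ↦ (Real.exp (X * t) : ℂ)) ((X * Real.exp (X * t) : ℝ) : ℂ) t :=
  ((((hasDerivAt_id' t).const_mul X).exp).congr_deriv (by ring)).ofReal_comp

/-- `e^{-Xt} e^{Xt} = 1` in `ℂ`. [folklore] -/
theorem ofReal_exp_neg_mul_exp (X t : ℝ) :
    (Real.exp (-(X * t)) : ℂ) * (Real.exp (X * t) : ℂ) = 1 := by
  rw [← Complex.ofReal_mul, ← Real.exp_add]; simp

/-- `P' = φ e^{X·}` (FTC-1). [folklore] -/
theorem hasDerivAt_P {φ : ℝ → ℂ} (hφ : Continuous φ) (X a t : ℝ) :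
    HasDerivAt (P φ X a) (φ t * (Real.exp (X * t) : ℂ)) t := by
  have hc : Continuous fun s : ℝ ↦ φ s * (Real.exp (X * s) : ℂ) := by fun_prop
  exact integral_hasDerivAt_right (hc.intervalIntegrable _ _) (hc.stronglyMeasurableAtFilter _ _)
    hc.continuousAt

/-- `Q' = -φ e^{-X·}` (FTC-1). [folklore] -/
theorem hasDerivAt_Q {φ : ℝ → ℂ} (hφ : Continuous φ) (X b t : ℝ) :
    HasDerivAt (Q φ X b) (-(φ t * (Real.exp (-(X * t)) : ℂ))) t := by
  have hc : Continuous fun s : ℝ ↦ φ s * (Real.exp (-(X * s)) : ℂ) := by fun_prop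
  exact integral_hasDerivAt_left (hc.intervalIntegrable _ _) (hc.stronglyMeasurableAtFilter _ _)
    hc.continuousAt

/-- `U' = V` (the `φ`-terms cancel). [folklore] -/
theorem hasDerivAt_U {φ : ℝ → ℂ} (hφ : Continuous φ) (X a b t : ℝ) :
    HasDerivAt (U φ X a b) (V φ X a b t) t := by
  have h := ((hasDerivAt_ofReal_exp_neg X t).mul (hasDerivAt_P hφ X a t)).add
    ((hasDerivAt_ofReal_exp X t).mul (hasDerivAt_Q hφ X b t))
  refine h.congr_deriv ?_
  simp only [V, Complex.ofReal_mul, Complex.ofReal_neg]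
  ring

/-- `V' = X² U − 2X φ` (so `U'' = X² U − 2Xφ`). [folklore] -/
theorem hasDerivAt_V {φ : ℝ → ℂ} (hφ : Continuous φ) (X a b t : ℝ) :
    HasDerivAt (V φ X a b) ((X : ℂ) ^ 2 * U φ X a b t - 2 * (X : ℂ) * φ t) t := by
  have h := (((hasDerivAt_ofReal_exp_neg X t).mul (hasDerivAt_P hφ X a t)).const_mul (-(X : ℂ))).add
    (((hasDerivAt_ofReal_exp X t).mul (hasDerivAt_Q hφ X b t)).const_mul (X : ℂ))
  have hfun : V φ X a b = fun t ↦ -(X : ℂ) * ((Real.exp (-(X * t)) : ℂ) * P φ X a t)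
      + (X : ℂ) * ((Real.exp (X * t) : ℂ) * Q φ X b t) := by
    funext t; simp only [V]; ring
  rw [hfun]
  refine h.congr_deriv ?_
  simp only [U, Complex.ofReal_mul, Complex.ofReal_neg]
  linear_combination (-(2 : ℂ) * X * φ t) * ofReal_exp_neg_mul_exp X t

/-- `P(a) = 0`. [folklore] -/
theorem P_self (φ : ℝ → ℂ) (X a : ℝ) : P φ X a a = 0 := by simp [P]

/-- `Q(b) = 0`. [folklore] -/
theorem Q_self (φ : ℝ → ℂ) (X b : ℝ) : Q φ X b b = 0 := by simp [Q]

/-- **The energy identity.** For continuous `φ`: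
`2X ∫_a^b conj(φ) U = X² ∫_a^b ‖U‖² + ∫_a^b ‖V‖² + X(‖U(b)‖² + ‖U(a)‖²)`, from `U'' = X²U − 2Xφ`,
one integration by parts, and the boundary relations `V(b) = −X U(b)`, `V(a) = X U(a)`
(`P(a) = 0 = Q(b)`). This is the classical proof that `e^{-X|t|}` is a positive-definite
function. [folklore] -/
theorem energy_identity {φ : ℝ → ℂ} (hφ : Continuous φ) (X a b : ℝ) :
    2 * (X : ℂ) * ∫ t in a..b, conj (φ t) * U φ X a b t
      = (X : ℂ) ^ 2 * ((∫ t in a..b, ‖U φ X a b t‖ ^ 2 : ℝ) : ℂ)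
        + ((∫ t in a..b, ‖V φ X a b t‖ ^ 2 : ℝ) : ℂ)
        + (X : ℂ) * ((‖U φ X a b b‖ ^ 2 + ‖U φ X a b a‖ ^ 2 : ℝ) : ℂ) := by
  set U' := U φ X a b with hU'
  set V' := V φ X a b with hV'
  have hU : ∀ t, HasDerivAt U' (V' t) t := hasDerivAt_U hφ X a b
  have hV : ∀ t, HasDerivAt V' ((X : ℂ) ^ 2 * U' t - 2 * (X : ℂ) * φ t) t := hasDerivAt_V hφ X a b
  have hUc : Continuous U' := continuous_iff_continuousAt.2 fun t ↦ (hU t).continuousAt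
  have hVc : Continuous V' := continuous_iff_continuousAt.2 fun t ↦ (hV t).continuousAt
  have hW : Continuous fun t ↦ (X : ℂ) ^ 2 * U' t - 2 * (X : ℂ) * φ t := by fun_prop
  have hcV : ∀ t, HasDerivAt (fun t ↦ conj (V' t)) (conj ((X : ℂ) ^ 2 * U' t - 2 * (X : ℂ) * φ t)) t :=
    fun t ↦ (hV t).star
  -- integration by parts: ∫ conj(V) V = conj(V b) U b - conj(V a) U a - ∫ conj(V') U
  have hparts := integral_mul_deriv_eq_deriv_mul (a := a) (b := b)
    (u := fun t ↦ conj (V' t)) (v := U')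
    (u' := fun t ↦ conj ((X : ℂ) ^ 2 * U' t - 2 * (X : ℂ) * φ t)) (v' := V')
    (fun t _ ↦ hcV t) (fun t _ ↦ hU t)
    ((Complex.continuous_conj.comp hW).intervalIntegrable _ _) (hVc.intervalIntegrable _ _)
  beta_reduce at hparts
  -- boundary relations
  have hVb : V' b = -(X : ℂ) * U' b := by
    simp only [hV', hU', V, U, Q_self φ X b, mul_zero, add_zero]; ring
  have hVa : V' a = (X : ℂ) * U' a := by
    simp only [hV', hU', V, U, P_self φ X a, mul_zero, zero_add]; ring
  -- the four integrals
  have hI2 : ∫ t in a..b, conj (U' t) * U' t = ((∫ t in a..b, ‖U' t‖ ^ 2 : ℝ) : ℂ) := by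
    rw [← intervalIntegral.integral_ofReal]
    refine integral_congr fun t _ ↦ ?_
    rw [Complex.conj_mul']
    norm_cast
  have hI3 : ∫ t in a..b, conj (V' t) * V' t = ((∫ t in a..b, ‖V' t‖ ^ 2 : ℝ) : ℂ) := by
    rw [← intervalIntegral.integral_ofReal]
    refine integral_congr fun t _ ↦ ?_
    rw [Complex.conj_mul']
    norm_cast
  have hint1 : IntervalIntegrable (fun t ↦ conj (U' t) * U' t) volume a b :=
    ((Complex.continuous_conj.comp hUc).mul hUc).intervalIntegrable _ _
  have hint2 : IntervalIntegrable (fun t ↦ conj (φ t) * U' t) volume a b :=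
    ((Complex.continuous_conj.comp hφ).mul hUc).intervalIntegrable _ _
  have hI4 : ∫ t in a..b, conj ((X : ℂ) ^ 2 * U' t - 2 * (X : ℂ) * φ t) * U' t
      = (X : ℂ) ^ 2 * (∫ t in a..b, conj (U' t) * U' t)
        - 2 * (X : ℂ) * ∫ t in a..b, conj (φ t) * U' t := by
    have hpt : ∀ t, conj ((X : ℂ) ^ 2 * U' t - 2 * (X : ℂ) * φ t) * U' t
        = (X : ℂ) ^ 2 * (conj (U' t) * U' t) - 2 * (X : ℂ) * (conj (φ t) * U' t) := by
      intro t
      simp only [map_sub, map_mul, map_pow, Complex.conj_ofReal, map_ofNat]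
      ring
    simp_rw [hpt]
    rw [intervalIntegral.integral_sub (hint1.const_mul _) (hint2.const_mul _),
      intervalIntegral.integral_const_mul, intervalIntegral.integral_const_mul]
  have hbd : conj (V' b) * U' b - conj (V' a) * U' a
      = -(X : ℂ) * ((‖U' b‖ ^ 2 + ‖U' a‖ ^ 2 : ℝ) : ℂ) := by
    rw [hVb, hVa]
    simp only [map_mul, map_neg, Complex.conj_ofReal]
    push_cast
    rw [← Complex.conj_mul' (U' b), ← Complex.conj_mul' (U' a)]
    ring
  rw [hI3, hI4, hI2, hbd] at hparts
  linear_combination (-1 : ℂ) * hparts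

/-- Hence `Re ∫_a^b conj(φ) U ≥ 0` for `X > 0`, `a ≤ b` (indeed the integral is real and
non-negative). [folklore] -/
theorem re_integral_conj_mul_U_nonneg {φ : ℝ → ℂ} (hφ : Continuous φ) {X a b : ℝ} (hab : a ≤ b)
    (hX : 0 < X) : 0 ≤ (∫ t in a..b, conj (φ t) * U φ X a b t).re := by
  have h := energy_identity hφ X a b
  set I := ∫ t in a..b, conj (φ t) * U φ X a b t with hI
  set A := ∫ t in a..b, ‖U φ X a b t‖ ^ 2 with hA
  set B := ∫ t in a..b, ‖V φ X a b t‖ ^ 2 with hB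
  set C := ‖U φ X a b b‖ ^ 2 + ‖U φ X a b a‖ ^ 2 with hC
  have h1 : 0 ≤ A := intervalIntegral.integral_nonneg hab fun t _ ↦ by positivity
  have h2 : 0 ≤ B := intervalIntegral.integral_nonneg hab fun t _ ↦ by positivity
  have h3 : 0 ≤ C := by positivity
  have h' : ((2 * X : ℝ) : ℂ) * I = ((X ^ 2 * A + B + X * C : ℝ) : ℂ) := by
    push_cast
    linear_combination h
  have h'' := congrArg Complex.re h'
  rw [Complex.re_ofReal_mul, Complex.ofReal_re] at h''
  have h4 : 0 ≤ 2 * X * I.re := by rw [h'']; positivity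
  nlinarith

/-! ### `U` is the convolution with `e^{-X|·|}` on `[a, b]` -/

/-- For `t ∈ [a, b]`: `∫_a^b φ(s) e^{-X|t−s|} ds = U(t)` (split at `s = t`). [folklore] -/
theorem integral_mul_exp_neg_abs {φ : ℝ → ℂ} (hφ : Continuous φ) (X : ℝ) {a b t : ℝ}
    (hat : a ≤ t) (htb : t ≤ b) :
    ∫ s in a..b, φ s * (Real.exp (-(X * |t - s|)) : ℂ) = U φ X a b t := by
  have hc : Continuous fun s : ℝ ↦ φ s * (Real.exp (-(X * |t - s|)) : ℂ) := by fun_prop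
  rw [← integral_add_adjacent_intervals (b := t) (hc.intervalIntegrable _ _) (hc.intervalIntegrable _ _)]
  simp only [U, P, Q]
  rw [← intervalIntegral.integral_const_mul, ← intervalIntegral.integral_const_mul]
  congr 1
  · refine integral_congr fun s hs ↦ ?_
    rw [uIcc_of_le hat] at hs
    rw [abs_of_nonneg (by linarith [hs.2]), mul_left_comm, ← Complex.ofReal_mul, ← Real.exp_add,
      show -(X * t) + X * s = -(X * (t - s)) by ring]
  · refine integral_congr fun s hs ↦ ?_
    rw [uIcc_of_le htb] at hs
    rw [abs_of_nonpos (by linarith [hs.1]), mul_left_comm, ← Complex.ofReal_mul, ← Real.exp_add,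
      show X * t + -(X * s) = -(X * -(t - s)) by ring]

/-- **Positive-definiteness of `e^{-X|t|}` in integral form.** For continuous `φ : ℝ → ℂ`,
`X > 0` and `a ≤ b`: `Re ∫_a^b ∫_a^b conj(φ(t)) φ(s) e^{-X|t−s|} ds dt ≥ 0`. [folklore] -/
theorem re_double_integral_exp_neg_abs_nonneg {φ : ℝ → ℂ} (hφ : Continuous φ) {X a b : ℝ}
    (hab : a ≤ b) (hX : 0 < X) :
    0 ≤ (∫ t in a..b, conj (φ t) * ∫ s in a..b, φ s * (Real.exp (-(X * |t - s|)) : ℂ)).re := by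
  have heq : ∫ t in a..b, conj (φ t) * ∫ s in a..b, φ s * (Real.exp (-(X * |t - s|)) : ℂ)
      = ∫ t in a..b, conj (φ t) * U φ X a b t := by
    refine integral_congr fun t ht ↦ ?_
    rw [uIcc_of_le hab] at ht
    rw [integral_mul_exp_neg_abs hφ X ht.1 ht.2]
  rw [heq]
  exact re_integral_conj_mul_U_nonneg hφ hab hX

/-- The case `X = 0`: `∫∫ conj(φ(t)) φ(s) = |∫ φ|² ≥ 0`. [folklore] -/
theorem re_double_integral_nonneg_zero (φ : ℝ → ℂ) (a b : ℝ) :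
    0 ≤ (∫ t in a..b, conj (φ t) * ∫ s in a..b, φ s).re := by
  rw [intervalIntegral.integral_mul_const]
  have : ∫ t in a..b, conj (φ t) = conj (∫ t in a..b, φ t) := by
    simp only [intervalIntegral, map_sub, ← integral_conj]
  rw [this, Complex.conj_mul']
  norm_cast
  positivity

end ExpKernel



/-! ## Continuity and support of Ford's `g`; `w` on `[-2a, 2a]` -/

/-- `g` vanishes at and beyond the endpoint: `fordG θ u = 0` for `|u| ≥ θ cot θ` (`0 < θ < π/2`;
at `|u| = θ cot θ`, `cos(u tan θ) = cos θ`). [cite: MossinghoffTrudgianYangRNT2024, (4.3)] -/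
theorem fordG_of_le_abs {θ u : ℝ} (hθ : 0 < θ) (hθ' : θ < π / 2) (h : θ * Real.cot θ ≤ |u|) :
    fordG θ u = 0 := by
  rcases h.lt_or_eq with h | h
  · exact fordG_of_lt_abs h
  · rw [fordG_of_abs_le h.symm.le]
    have hs : Real.sin θ ≠ 0 := (Real.sin_pos_of_pos_of_lt_pi hθ (by linarith [Real.pi_pos])).ne'
    have hc : Real.cos θ ≠ 0 := (Real.cos_pos_of_mem_Ioo ⟨by linarith, hθ'⟩).ne'
    have h1 : |u| * Real.tan θ = θ := by
      rw [← h, Real.cot_eq_cos_div_sin, Real.tan_eq_sin_div_cos]; field_simp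
    have h2 : Real.cos (u * Real.tan θ) = Real.cos θ := by
      rw [← Real.cos_abs, abs_mul, abs_of_pos (Real.tan_pos_of_pos_of_lt_pi_div_two hθ hθ'), h1]
    rw [h2, sub_self, zero_div]

/-- An `if`-free formula: `g(u) = (cos(tan θ · min(|u|, θ cot θ)) − cos θ) sec²θ`
(`0 < θ < π/2`). [cite: MossinghoffTrudgianYangRNT2024, (4.3)] -/
theorem fordG_eq_cos_min {θ : ℝ} (hθ : 0 < θ) (hθ' : θ < π / 2) (u : ℝ) :
    fordG θ u = (Real.cos (Real.tan θ * min |u| (θ * Real.cot θ)) - Real.cos θ) / Real.cos θ ^ 2 := by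
  have htan : 0 < Real.tan θ := Real.tan_pos_of_pos_of_lt_pi_div_two hθ hθ'
  rcases le_or_gt |u| (θ * Real.cot θ) with h | h
  · rw [fordG_of_abs_le h, min_eq_left h]
    congr 2
    rw [← Real.cos_abs (u * Real.tan θ), abs_mul, abs_of_pos htan, mul_comm |u|]
  · rw [fordG_of_lt_abs h, min_eq_right h.le]
    have hs : Real.sin θ ≠ 0 := (Real.sin_pos_of_pos_of_lt_pi hθ (by linarith [Real.pi_pos])).ne'
    have hc : Real.cos θ ≠ 0 := (Real.cos_pos_of_mem_Ioo ⟨by linarith, hθ'⟩).ne'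
    have h1 : Real.tan θ * (θ * Real.cot θ) = θ := by
      rw [Real.cot_eq_cos_div_sin, Real.tan_eq_sin_div_cos]; field_simp
    rw [h1, sub_self, zero_div]

/-- `g` is continuous (`0 < θ < π/2`). [folklore] -/
theorem continuous_fordG {θ : ℝ} (hθ : 0 < θ) (hθ' : θ < π / 2) : Continuous (fordG θ) := by
  have : fordG θ = fun u ↦
      (Real.cos (Real.tan θ * min |u| (θ * Real.cot θ)) - Real.cos θ) / Real.cos θ ^ 2 :=
    funext (fordG_eq_cos_min hθ hθ')
  rw [this]
  fun_prop

/-- `w(v) = ∫_{-θcotθ}^{θcotθ} g(t) g(t − v) dt` (using `g` even and `g = 0` off `[−θ cot θ, θ cot θ]`).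
[folklore] -/
theorem fordW_eq_intervalIntegral_sub {θ : ℝ} (hθ : 0 < θ) (hθ' : θ < π / 2) (v : ℝ) :
    fordW θ v = ∫ t in (-(θ * Real.cot θ))..(θ * Real.cot θ), fordG θ t * fordG θ (t - v) := by
  set a := θ * Real.cot θ with ha
  have hapos : 0 < a := theta_mul_cot_pos hθ hθ'
  unfold fordW
  have h1 : (fun t ↦ fordG θ t * fordG θ (v - t))
      = (Icc (-a) a).indicator fun t ↦ fordG θ t * fordG θ (t - v) := by
    funext t
    by_cases ht : t ∈ Icc (-a) a
    · rw [indicator_of_mem ht, show v - t = -(t - v) by ring, fordG_neg]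
    · rw [indicator_of_notMem ht]
      rw [mem_Icc, not_and_or, not_le, not_le] at ht
      have : a < |t| := by
        rcases ht with ht | ht
        · exact lt_of_lt_of_le (by linarith) (neg_le_abs t)
        · exact lt_of_lt_of_le ht (le_abs_self t)
      rw [fordG_of_lt_abs this, zero_mul]
  rw [h1, MeasureTheory.integral_indicator measurableSet_Icc, integral_Icc_eq_integral_Ioc,
    intervalIntegral.integral_of_le (by linarith)]

/-- On `[-2θ cot θ, 2θ cot θ]`, `w(v) = h^{(1)}_{1,θ}(|v|)` (closed form plus evenness).
[cite: MossinghoffTrudgianYangRNT2024, (4.3) and (9.2)] -/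
theorem fordW_eq_mtyH1_abs {θ v : ℝ} (hθ : 0 < θ) (hθ' : θ < π / 2)
    (hv : |v| ≤ 2 * (θ * Real.cot θ)) : fordW θ v = mtyH1 1 θ |v| := by
  rcases le_or_gt 0 v with h | h
  · rw [abs_of_nonneg h] at hv ⊢
    exact fordW_eq_mtyH1 hθ hθ' h hv
  · rw [abs_of_neg h] at hv ⊢
    rw [← fordW_neg, fordW_eq_mtyH1 hθ hθ' (by linarith) hv]

/-! ## Kadiri's (H₂) for `h^{(1)}_{1,θ}`: the Laplace transform has non-negative real part -/

/-- The two-variable integrand `M(t, v) = g(t) g(t − v) e^{-X|v|} e^{iYv}`. [folklore] -/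
def fordM (θ X Y t v : ℝ) : ℂ :=
  ((fordG θ t * fordG θ (t - v) : ℝ) : ℂ) * (Real.exp (-(X * |v|)) : ℂ) * Complex.exp (Complex.I * Y * v)

/-- `M` is jointly continuous. [folklore] -/
theorem continuous_fordM {θ : ℝ} (hθ : 0 < θ) (hθ' : θ < π / 2) (X Y : ℝ) :
    Continuous (fun p : ℝ × ℝ ↦ fordM θ X Y p.1 p.2) := by
  have hg := continuous_fordG hθ hθ'
  unfold fordM
  fun_prop

/-- `M(t, v) = 0` when `|t − v| ≥ θ cot θ`. [folklore] -/
theorem fordM_eq_zero {θ : ℝ} (hθ : 0 < θ) (hθ' : θ < π / 2) (X Y : ℝ) {t v : ℝ}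
    (h : θ * Real.cot θ ≤ |t - v|) : fordM θ X Y t v = 0 := by
  simp [fordM, fordG_of_le_abs hθ hθ' h]

/-- The test function `φ(s) = g(s) e^{-iYs}`. [folklore] -/
def fordPhi (θ Y s : ℝ) : ℂ := (fordG θ s : ℂ) * Complex.exp (-(Complex.I * Y * s))

/-- `φ` is continuous. [folklore] -/
theorem continuous_fordPhi {θ : ℝ} (hθ : 0 < θ) (hθ' : θ < π / 2) (Y : ℝ) :
    Continuous (fordPhi θ Y) := by
  have hg := continuous_fordG hθ hθ'
  unfold fordPhi
  fun_prop

/-- `conj(φ(t)) = g(t) e^{iYt}`. [folklore] -/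
theorem conj_fordPhi (θ Y t : ℝ) :
    conj (fordPhi θ Y t) = (fordG θ t : ℂ) * Complex.exp (Complex.I * Y * t) := by
  rw [fordPhi, map_mul, Complex.conj_ofReal, ← Complex.exp_conj]
  congr 2
  simp only [map_neg, map_mul, Complex.conj_I, Complex.conj_ofReal]
  ring

/-- `conj(φ(t)) φ(s) e^{-X|t−s|} = M(t, t − s)`. [folklore] -/
theorem conj_fordPhi_mul (θ X Y t s : ℝ) :
    conj (fordPhi θ Y t) * (fordPhi θ Y s * (Real.exp (-(X * |t - s|)) : ℂ))
      = fordM θ X Y t (t - s) := by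
  rw [conj_fordPhi, fordPhi, fordM, sub_sub_cancel]
  have hexp : Complex.exp (Complex.I * Y * t) * Complex.exp (-(Complex.I * Y * s))
      = Complex.exp (Complex.I * Y * ((t - s : ℝ) : ℂ)) := by
    rw [← Complex.exp_add]; push_cast; ring_nf
  calc (fordG θ t : ℂ) * Complex.exp (Complex.I * Y * t)
        * ((fordG θ s : ℂ) * Complex.exp (-(Complex.I * Y * s)) * (Real.exp (-(X * |t - s|)) : ℂ))
      = (fordG θ t : ℂ) * (fordG θ s : ℂ) * (Real.exp (-(X * |t - s|)) : ℂ)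
        * (Complex.exp (Complex.I * Y * t) * Complex.exp (-(Complex.I * Y * s))) := by ring
    _ = _ := by rw [hexp]; push_cast; ring

/-- Steps (ii)–(iii): for `|t| ≤ a = θ cot θ`,
`∫_{-a}^{a} conj(φ(t)) φ(s) e^{-X|t−s|} ds = ∫_{-2a}^{2a} M(t, v) dv` (substitute `v = t − s`,
then enlarge the window using `g(t − v) = 0` for `|t − v| ≥ a`). [folklore] -/
theorem fordPhi_inner_integral_eq {θ : ℝ} (hθ : 0 < θ) (hθ' : θ < π / 2) (X Y : ℝ) {t : ℝ}
    (ht : |t| ≤ θ * Real.cot θ) :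
    ∫ s in (-(θ * Real.cot θ))..(θ * Real.cot θ),
        conj (fordPhi θ Y t) * (fordPhi θ Y s * (Real.exp (-(X * |t - s|)) : ℂ))
      = ∫ v in (-(2 * (θ * Real.cot θ)))..(2 * (θ * Real.cot θ)), fordM θ X Y t v := by
  set a := θ * Real.cot θ with ha
  have hapos : 0 < a := theta_mul_cot_pos hθ hθ'
  simp_rw [conj_fordPhi_mul]
  rw [intervalIntegral.integral_comp_sub_left (fordM θ X Y t) t]
  have hcont : Continuous (fordM θ X Y t) :=
    (continuous_fordM hθ hθ' X Y).comp (Continuous.prodMk_right t)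
  have hint : ∀ p q : ℝ, IntervalIntegrable (fordM θ X Y t) volume p q :=
    fun p q ↦ hcont.intervalIntegrable p q
  have hta := abs_le.1 ht
  have hleft : ∫ v in (-(2 * a))..(t - a), fordM θ X Y t v = 0 := by
    have hz : EqOn (fordM θ X Y t) (fun _ ↦ 0) (uIcc (-(2 * a)) (t - a)) := fun v hv ↦ by
      rw [uIcc_of_le (by linarith)] at hv
      exact fordM_eq_zero hθ hθ' X Y (le_trans (by linarith [hv.2]) (le_abs_self _))
    rw [integral_congr hz, intervalIntegral.integral_zero]
  have hright : ∫ v in (t + a)..(2 * a), fordM θ X Y t v = 0 := by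
    have hz : EqOn (fordM θ X Y t) (fun _ ↦ 0) (uIcc (t + a) (2 * a)) := fun v hv ↦ by
      rw [uIcc_of_le (by linarith)] at hv
      exact fordM_eq_zero hθ hθ' X Y (le_trans (by linarith [hv.1]) (neg_le_abs _))
    rw [integral_congr hz, intervalIntegral.integral_zero]
  rw [show t - -a = t + a by ring,
    ← integral_add_adjacent_intervals (a := -(2 * a)) (b := t - a) (c := 2 * a) (hint _ _) (hint _ _),
    ← integral_add_adjacent_intervals (a := t - a) (b := t + a) (c := 2 * a) (hint _ _) (hint _ _),
    hleft, hright]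
  ring

/-- Steps (iv)–(v): swapping the order of integration and recognising `w = g ∗ g` in its
closed form: `∫_{-a}^{a} ∫_{-2a}^{2a} M(t, v) dv dt = ∫_{-2a}^{2a} h^{(1)}_{1,θ}(|v|) e^{-X|v|} e^{iYv} dv`.
[cite: MossinghoffTrudgianYangRNT2024, (4.3) and (9.2)] -/
theorem fordM_double_integral_eq {θ : ℝ} (hθ : 0 < θ) (hθ' : θ < π / 2) (X Y : ℝ) :
    ∫ t in (-(θ * Real.cot θ))..(θ * Real.cot θ),
        ∫ v in (-(2 * (θ * Real.cot θ)))..(2 * (θ * Real.cot θ)), fordM θ X Y t v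
      = ∫ v in (-(2 * (θ * Real.cot θ)))..(2 * (θ * Real.cot θ)),
          (mtyH1 1 θ |v| : ℂ) * (Real.exp (-(X * |v|)) : ℂ) * Complex.exp (Complex.I * Y * v) := by
  set a := θ * Real.cot θ with ha
  have hapos : 0 < a := theta_mul_cot_pos hθ hθ'
  have hM := continuous_fordM hθ hθ' X Y
  have hI : IntegrableOn (Function.uncurry fun t v ↦ fordM θ X Y t v)
      (uIoc (-a) a ×ˢ uIoc (-(2 * a)) (2 * a)) := by
    have hK : IsCompact (Icc (-a) a ×ˢ Icc (-(2 * a)) (2 * a)) := isCompact_Icc.prod isCompact_Icc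
    refine (hM.continuousOn.integrableOn_compact hK).mono_set ?_
    rw [uIoc_of_le (by linarith), uIoc_of_le (by linarith)]
    exact prod_mono Ioc_subset_Icc_self Ioc_subset_Icc_self
  rw [MeasureTheory.intervalIntegral_intervalIntegral_swap hI]
  refine integral_congr fun v hv ↦ ?_
  rw [uIcc_of_le (by linarith)] at hv
  have h1 : ∫ t in (-a)..a, fordM θ X Y t v
      = (∫ t in (-a)..a, ((fordG θ t * fordG θ (t - v) : ℝ) : ℂ))
        * ((Real.exp (-(X * |v|)) : ℂ) * Complex.exp (Complex.I * Y * v)) := by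
    rw [← intervalIntegral.integral_mul_const]
    refine integral_congr fun t _ ↦ ?_
    simp only [fordM]; ring
  rw [h1, intervalIntegral.integral_ofReal, ← fordW_eq_intervalIntegral_sub hθ hθ' v,
    fordW_eq_mtyH1_abs hθ hθ' (abs_le.2 ⟨by linarith [hv.1], hv.2⟩)]
  ring

/-- Step (vi): the real part, folded onto `[0, 2a]` by evenness:
`Re ∫_{-2a}^{2a} h(|v|) e^{-X|v|} e^{iYv} dv = 2 ∫_0^{2a} h(v) e^{-Xv} cos(Yv) dv`. [folklore] -/
theorem re_weighted_integral_eq (θ X Y : ℝ) {b : ℝ} (hb : 0 ≤ b) :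
    (∫ v in (-b)..b,
        (mtyH1 1 θ |v| : ℂ) * (Real.exp (-(X * |v|)) : ℂ) * Complex.exp (Complex.I * Y * v)).re
      = 2 * ∫ v in (0 : ℝ)..b, mtyH1 1 θ v * Real.exp (-(X * v)) * Real.cos (Y * v) := by
  set F : ℝ → ℂ := fun v ↦
    (mtyH1 1 θ |v| : ℂ) * (Real.exp (-(X * |v|)) : ℂ) * Complex.exp (Complex.I * Y * v) with hF
  have hcont : Continuous F := by
    have := continuous_mtyH1 1 θ
    rw [hF]; fun_prop
  have hre : ∀ v, (F v).re = mtyH1 1 θ |v| * Real.exp (-(X * |v|)) * Real.cos (Y * v) := by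
    intro v
    simp only [hF]
    rw [← Complex.ofReal_mul, Complex.re_ofReal_mul, Complex.exp_re]
    simp [Complex.mul_re, Complex.mul_im]
  -- `re` commutes with the integral
  have h1 : (∫ v in (-b)..b, F v).re = ∫ v in (-b)..b, (F v).re := by
    have := (Complex.reCLM.intervalIntegral_comp_comm (hcont.intervalIntegrable (μ := volume) (-b) b))
    simpa using this.symm
  rw [h1]
  simp_rw [hre]
  -- fold by evenness
  set f : ℝ → ℝ := fun v ↦ mtyH1 1 θ |v| * Real.exp (-(X * |v|)) * Real.cos (Y * v) with hf
  have hfc : Continuous f := by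
    have := continuous_mtyH1 1 θ
    rw [hf]; fun_prop
  have heven : ∀ v, f (-v) = f v := fun v ↦ by simp [hf, abs_neg, Real.cos_neg, mul_neg]
  have hsplit : ∫ v in (-b)..b, f v = (∫ v in (-b)..0, f v) + ∫ v in (0 : ℝ)..b, f v :=
    (integral_add_adjacent_intervals (hfc.intervalIntegrable _ _) (hfc.intervalIntegrable _ _)).symm
  have hneg : ∫ v in (-b)..0, f v = ∫ v in (0 : ℝ)..b, f v := by
    have := intervalIntegral.integral_comp_neg (a := 0) (b := b) f
    rw [neg_zero] at this
    rw [← this]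
    exact integral_congr fun v _ ↦ heven v
  have hpos : ∫ v in (0 : ℝ)..b, f v
      = ∫ v in (0 : ℝ)..b, mtyH1 1 θ v * Real.exp (-(X * v)) * Real.cos (Y * v) := by
    refine integral_congr fun v hv ↦ ?_
    rw [uIcc_of_le hb] at hv
    simp only [hf, abs_of_nonneg hv.1]
  rw [hsplit, hneg, hpos]
  ring


/-! ## Assembly: (H₂) -/

/-- **Kadiri's hypothesis (H₂) for the kernel of Mossinghoff–Trudgian–Yang (9.2).** For
`0 < θ < π/2`, every `X ≥ 0` and every real `Y`,
`F̃(X, Y) := ∫₀^{d₁(θ)} h^{(1)}_{1,θ}(u) e^{−Xu} cos(Yu) du ≥ 0`,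
i.e. the Laplace transform of `h^{(1)}_{1,θ}` has non-negative real part on the closed right
half-plane. This is condition (H₂) of Kadiri 2005, §2 ("`F̃(X,Y) ≥ 0 si X ≥ 0`", required of the
test function and there taken from Heath-Brown 1992, Lemma 7.5) for the kernel used in MTY §9.
Proof: `h^{(1)}_{1,θ} = g ∗ g` on `[0, 2θ cot θ]` with Ford's even `g ≥ 0`
(`fordW_eq_mtyH1`), so `2F̃(X,Y) = Re ∫∫ conj(φ(t)) φ(s) e^{−X|t−s|} ds dt` with
`φ = g e^{−iY·}` (`fordPhi_inner_integral_eq`, `fordM_double_integral_eq`,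
`re_weighted_integral_eq`), which is `≥ 0` by the positive-definiteness of `e^{−X|·|}`
(`ExpKernel.re_double_integral_exp_neg_abs_nonneg`, the energy identity). 
[cite: Kadiri2005, §2 (H₂)] [cite: MossinghoffTrudgianYangRNT2024, §9 and (9.2)] -/
theorem mtyH1_laplace_re_nonneg {θ : ℝ} (hθ : 0 < θ) (hθ' : θ < π / 2) {X : ℝ} (hX : 0 ≤ X)
    (Y : ℝ) : 0 ≤ ∫ u in (0 : ℝ)..mtyD1 θ, mtyH1 1 θ u * Real.exp (-(X * u)) * Real.cos (Y * u) := by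
  set a := θ * Real.cot θ with ha
  have hapos : 0 < a := theta_mul_cot_pos hθ hθ'
  have hD : mtyD1 θ = 2 * a := by rw [ha]; unfold mtyD1; ring
  have hφ := continuous_fordPhi hθ hθ' Y
  -- the chain of identities
  have key : (∫ t in (-a)..a, conj (fordPhi θ Y t) *
        ∫ s in (-a)..a, fordPhi θ Y s * (Real.exp (-(X * |t - s|)) : ℂ)).re
      = 2 * ∫ v in (0 : ℝ)..(2 * a), mtyH1 1 θ v * Real.exp (-(X * v)) * Real.cos (Y * v) := by
    have h1 : ∫ t in (-a)..a, conj (fordPhi θ Y t) *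
          ∫ s in (-a)..a, fordPhi θ Y s * (Real.exp (-(X * |t - s|)) : ℂ)
        = ∫ t in (-a)..a, ∫ v in (-(2 * a))..(2 * a), fordM θ X Y t v := by
      refine integral_congr fun t ht ↦ ?_
      rw [uIcc_of_le (by linarith)] at ht
      rw [← intervalIntegral.integral_const_mul]
      exact fordPhi_inner_integral_eq hθ hθ' X Y (abs_le.2 ⟨ht.1, ht.2⟩)
    rw [h1, fordM_double_integral_eq hθ hθ' X Y, re_weighted_integral_eq θ X Y (by linarith)]
  -- positivity of the left-hand side
  have hnonneg : 0 ≤ (∫ t in (-a)..a, conj (fordPhi θ Y t) *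
        ∫ s in (-a)..a, fordPhi θ Y s * (Real.exp (-(X * |t - s|)) : ℂ)).re := by
    rcases hX.lt_or_eq with hX | hX
    · exact ExpKernel.re_double_integral_exp_neg_abs_nonneg hφ (by linarith) hX
    · rw [← hX]
      simp only [zero_mul, neg_zero, Real.exp_zero, Complex.ofReal_one, mul_one]
      exact ExpKernel.re_double_integral_nonneg_zero (fordPhi θ Y) (-a) a
  rw [hD]
  linarith

/-- (H₂) in complex form: `Re ∫₀^{d₁} h^{(1)}_{1,θ}(u) e^{−(X+iY)u} du ≥ 0` for `X ≥ 0`.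
[cite: Kadiri2005, §2 (H₂)] -/
theorem mtyH1_laplace_re_nonneg' {θ : ℝ} (hθ : 0 < θ) (hθ' : θ < π / 2) {X : ℝ} (hX : 0 ≤ X)
    (Y : ℝ) :
    0 ≤ (∫ u in (0 : ℝ)..mtyD1 θ, (mtyH1 1 θ u : ℂ) * Complex.exp (-((X + Y * Complex.I) * u))).re := by
  have hcont : Continuous fun u : ℝ ↦ (mtyH1 1 θ u : ℂ) * Complex.exp (-((X + Y * Complex.I) * u)) := by
    have := continuous_mtyH1 1 θ
    fun_prop
  have h1 : (∫ u in (0 : ℝ)..mtyD1 θ, (mtyH1 1 θ u : ℂ) * Complex.exp (-((X + Y * Complex.I) * u))).re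
      = ∫ u in (0 : ℝ)..mtyD1 θ, ((mtyH1 1 θ u : ℂ) * Complex.exp (-((X + Y * Complex.I) * u))).re := by
    have := (Complex.reCLM.intervalIntegral_comp_comm (hcont.intervalIntegrable (μ := volume) 0 (mtyD1 θ)))
    simpa using this.symm
  have h2 : ∀ u : ℝ, ((mtyH1 1 θ u : ℂ) * Complex.exp (-((X + Y * Complex.I) * u))).re
      = mtyH1 1 θ u * Real.exp (-(X * u)) * Real.cos (Y * u) := by
    intro u
    rw [Complex.re_ofReal_mul, Complex.exp_re]
    simp only [Complex.neg_re, Complex.mul_re, Complex.add_re, Complex.ofReal_re, Complex.mul_im,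
      Complex.ofReal_im, Complex.I_re, Complex.I_im, Complex.add_im, Complex.neg_im]
    simp [Real.cos_neg, mul_assoc]
  rw [h1]
  simp_rw [h2]
  exact mtyH1_laplace_re_nonneg hθ hθ' hX Y

/-- (H₂) for the scaled test function `f(t) = η h^{(1)}_{1,θ}(ηt)` of Kadiri's method (§2.2:
`f(t) = η h_θ(ηt)`, supported on `[0, d₁(θ)/η]`): `∫₀^{d₁/η} f(t) e^{−Xt} cos(Yt) dt ≥ 0` for
`X ≥ 0`, `η > 0` (substitute `u = ηt`). [cite: Kadiri2005, §2.2 and (H₂)] -/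
theorem kadiri_f_laplace_re_nonneg {θ η : ℝ} (hθ : 0 < θ) (hθ' : θ < π / 2) (hη : 0 < η) {X : ℝ}
    (hX : 0 ≤ X) (Y : ℝ) :
    0 ≤ ∫ t in (0 : ℝ)..(mtyD1 θ / η), η * mtyH1 1 θ (η * t) * Real.exp (-(X * t)) * Real.cos (Y * t) := by
  have h := mtyH1_laplace_re_nonneg hθ hθ' (X := X / η) (by positivity) (Y / η)
  have hsub := intervalIntegral.smul_integral_comp_mul_left
    (fun u ↦ mtyH1 1 θ u * Real.exp (-(X / η * u)) * Real.cos (Y / η * u)) η (a := 0) (b := mtyD1 θ / η)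
  beta_reduce at hsub
  simp only [smul_eq_mul, mul_zero] at hsub
  rw [show η * (mtyD1 θ / η) = mtyD1 θ by field_simp] at hsub
  have hpt : (fun t ↦ η * mtyH1 1 θ (η * t) * Real.exp (-(X * t)) * Real.cos (Y * t))
      = fun t ↦ η * (mtyH1 1 θ (η * t) * Real.exp (-(X / η * (η * t))) * Real.cos (Y / η * (η * t))) := by
    funext t
    have e1 : X / η * (η * t) = X * t := by field_simp
    have e2 : Y / η * (η * t) = Y * t := by field_simp
    rw [e1, e2]; ring
  rw [hpt, intervalIntegral.integral_const_mul, hsub]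
  exact h


end Literature.NumberTheory.LFunctions
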